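import Mathlib.NumberTheory.Padics.RingHoms
import Mathlib.RingTheory.Ideal.Quotient.Index
import Mathlib.Algebra.Module.ZMod
import Mathlib.LinearAlgebra.Dimension.Finite
import Mathlib.FieldTheory.Finiteness
import Mathlib.RingTheory.Finiteness.Cardinality
import Mathlib.RingTheory.Valuation.Integers
import Literature.AlgebraicGeometry.Frobenioids.PadicValuativeEndomorphisms
import HarnessLib

/-!
# Units of a finite extension of `ℚ_p`: an infinitely divisible unit of `O_K` is `1`

Classical local-field input for Mochizuki, *The geometry of Frobenioids II*, Kyushu J. Math. **62**
(2008), §1, Theorem 1.2 (iv) (kurims p. 9: "`C` is also slim … follows formally from [FrdI] Prop. 1.13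
(iii) since, by assertion (i) [`C` is of unit-profinite type for `Λ = ℤ`], condition (b) of loc. cit.
[`⋂_{n} (O^×(A))^n = {1}`] is always satisfied") [cite: MochizukiFrdII2008, Thm 1.2 (iv) p.9].
For `K` a finite `ℚ_p`-algebra which is a field with a compatible valuative relation (abc-iut-L1-t4's
`PadicFld.IsPadicLocal`, unbundled) we prove, elementarily:

* `finite_integer_quotient_p`: `O_K / p O_K` is finite — it is an `𝔽_p`-vector space of dimension
  `≤ [K : ℚ_p]`, since elements of `O_K` linearly independent modulo `p` are linearly independent over
  `ℚ_p` (normalise a dependence relation so that its largest coefficient is `1` and reduce modulo `p`);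
  hence `O_K / p^k O_K` is finite for every `k` (`Ideal.finite_quotient_pow`);
* `eq_zero_of_forall_valuation_le_pow`: `⋂_k p^k O_K = 0` — by the commensurability
  `v(y)^n = v(p)^m` of `PadicValuativeEndomorphisms.lean` (abc-iut-L1-d10);
* `eq_one_of_forall_exists_pow_eq`: a unit `u ∈ O_K^×` admitting an `n`-th root in `K` for every
  `n ≥ 1` equals `1`: with `N_k := #(O_K / p^k O_K)^×`, `u = w^{N_k} ≡ 1 (mod p^k)` for all `k`.
PROOF-ONLY; no definitions. Node `FrdII:Thm1.2(iv)` (seat abc-iut-L1-d8), classical input.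
-/

namespace Literature.AlgebraicGeometry.Frobenioids

namespace PadicFrd

open ValuativeRel

universe u

variable {p : ℕ} [Fact p.Prime] {K : Type u} [Field K] [ValuativeRel K] [Algebra ℚ_[p] K]

/-! ### Elements of `ℤ_p` map into `O_K`, and are congruent to naturals modulo `p` -/

/-- Along a compatible `ℚ_p`-algebra structure, `ℤ_p` maps into `O_K`.
[cite: MochizukiFrdII2008, Ex 1.1 (i) p.7] -/
theorem valuation_algebraMap_padicInt_le_one
    (hc : ∀ a b : ℚ_[p], algebraMap ℚ_[p] K a ≤ᵥ algebraMap ℚ_[p] K b ↔ a ≤ᵥ b) (e : ℤ_[p]) :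
    valuation K (algebraMap ℚ_[p] K (e : ℚ_[p])) ≤ 1 := by
  rw [← (valuation K).vle_one_iff, ← map_one (algebraMap ℚ_[p] K), hc,
    Padic.mulValuation.vle_one_iff, padic_mulValuation_eq]
  split_ifs with h
  · exact zero_le
  · rw [← WithZero.exp_zero, WithZero.exp_le_exp, neg_nonpos]
    exact (Padic.norm_le_one_iff_val_nonneg _).mp e.2

/-- Every `c ∈ ℤ_p` is congruent modulo `p O_K` to a natural number `< p`: with `r := zmodRepr c`,
`v(c - r) ≤ v(p)`. [cite: MochizukiFrdII2008, Ex 1.1 (i) p.7] -/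
theorem valuation_algebraMap_sub_zmodRepr_le
    (hc : ∀ a b : ℚ_[p], algebraMap ℚ_[p] K a ≤ᵥ algebraMap ℚ_[p] K b ↔ a ≤ᵥ b) (c : ℤ_[p]) :
    valuation K (algebraMap ℚ_[p] K (c : ℚ_[p]) - (c.zmodRepr : K)) ≤ valuation K ((p : ℕ) : K) := by
  have h := PadicInt.sub_zmodRepr_mem c
  rw [PadicInt.maximalIdeal_eq_span_p, Ideal.mem_span_singleton] at h
  obtain ⟨e, he⟩ := h
  have he' : (c : ℚ_[p]) - (c.zmodRepr : ℚ_[p]) = (p : ℚ_[p]) * (e : ℚ_[p]) := by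
    have := congrArg (fun z : ℤ_[p] => (z : ℚ_[p])) he
    simpa using this
  have : algebraMap ℚ_[p] K (c : ℚ_[p]) - (c.zmodRepr : K) =
      ((p : ℕ) : K) * algebraMap ℚ_[p] K (e : ℚ_[p]) := by
    rw [← map_natCast (algebraMap ℚ_[p] K) c.zmodRepr, ← map_sub, he', map_mul, map_natCast]
  rw [this, map_mul]
  exact mul_le_of_le_one_right' (valuation_algebraMap_padicInt_le_one hc e)

/-! ### `⋂_k p^k O_K = 0` -/

variable [Module.Finite ℚ_[p] K]

/-- In a finite extension of `ℚ_p`, an element of valuation `≤ v(p)^k` for every `k` is `0`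
(the value group is commensurable with `v(p)`: `v(y)^n = v(p)^m`).
[cite: MochizukiFrdII2008, Thm 1.2 (iv) p.9] -/
theorem eq_zero_of_forall_valuation_le_pow
    (hc : ∀ a b : ℚ_[p], algebraMap ℚ_[p] K a ≤ᵥ algebraMap ℚ_[p] K b ↔ a ≤ᵥ b) {y : K}
    (hy : ∀ k : ℕ, valuation K y ≤ valuation K ((p : ℕ) : K) ^ k) : y = 0 := by
  by_contra h0
  obtain ⟨n, hn, m, hm⟩ := exists_pow_valuation_eq_zpow hc h0
  have hvp0 : valuation K ((p : ℕ) : K) ≠ 0 := (Valuation.ne_zero_iff _).mpr natCast_p_ne_zero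
  have hvp1 : valuation K ((p : ℕ) : K) < 1 := by
    have h1 : ¬ (1 : ℚ_[p]) ≤ᵥ ((p : ℕ) : ℚ_[p]) := by
      rw [Padic.mulValuation.vle_iff_le, map_one, not_le]
      have := Padic.valuation_p_lt_one (Padic.mulValuation (p := p))
      simpa using this
    have h2 : ¬ (algebraMap ℚ_[p] K 1) ≤ᵥ (algebraMap ℚ_[p] K ((p : ℕ) : ℚ_[p])) :=
      fun h => h1 ((hc _ _).mp h)
    rw [map_one, map_natCast, (valuation K).vle_iff_le, map_one, not_le] at h2
    exact h2
  -- `v(y)^n = v(p)^m ≤ v(p)^(k n)` for all `k`; take `k n > m`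
  have key : ∀ k : ℕ, valuation K ((p : ℕ) : K) ^ m ≤ valuation K ((p : ℕ) : K) ^ ((k * n : ℕ) : ℤ) :=
    fun k => by
      rw [← hm, zpow_natCast, pow_mul]
      exact pow_le_pow_left' (hy k) n
  have hlt : m < ((m.toNat + 1) * n : ℕ) := by
    have : m ≤ (m.toNat : ℤ) := Int.self_le_toNat m
    push_cast
    nlinarith
  have := key (m.toNat + 1)
  exact absurd this (not_le.mpr (zpow_lt_zpow_right_of_lt_one₀ (zero_lt_iff.mpr hvp0) hvp1 hlt))

/-! ### `O_K / p O_K` is finite -/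

/-- **`O_K / p O_K` is finite** for `K` a finite extension of `ℚ_p` (compatible valuative relation):
elements of `O_K` that are linearly independent over `𝔽_p` modulo `p` are linearly independent over
`ℚ_p`, so `dim_{𝔽_p} O_K/p O_K ≤ [K : ℚ_p]`. [cite: MochizukiFrdII2008, Thm 1.2 (iv) p.9] -/
theorem finite_integer_quotient_p
    (hc : ∀ a b : ℚ_[p], algebraMap ℚ_[p] K a ≤ᵥ algebraMap ℚ_[p] K b ↔ a ≤ᵥ b) :
    Finite ((valuation K).integer ⧸
      Ideal.span {(⟨((p : ℕ) : K), by
        change valuation K ((p : ℕ) : K) ≤ 1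
        rw [← map_natCast (algebraMap ℚ_[p] K), ← PadicInt.coe_natCast]
        exact valuation_algebraMap_padicInt_le_one hc _⟩ : (valuation K).integer)}) := by
  classical
  set π : 𝒪[K] := ⟨((p : ℕ) : K), by
        change valuation K ((p : ℕ) : K) ≤ 1
        rw [← map_natCast (algebraMap ℚ_[p] K), ← PadicInt.coe_natCast]
        exact valuation_algebraMap_padicInt_le_one hc _⟩ with hπ
  set I : Ideal 𝒪[K] := Ideal.span {π} with hI
  -- `p • x = 0` in `O / p O`: a `ZMod p`-module structure
  have hpI : ∀ x : 𝒪[K] ⧸ I, p • x = 0 := by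
    intro x
    obtain ⟨y, rfl⟩ := Ideal.Quotient.mk_surjective x
    rw [← map_nsmul, Ideal.Quotient.eq_zero_iff_mem, nsmul_eq_mul]
    change _ ∈ Ideal.span {π}
    rw [Ideal.mem_span_singleton]
    exact ⟨y, by ext; simp [hπ]⟩
  letI : Module (ZMod p) (𝒪[K] ⧸ I) := AddCommGroup.zmodModule hpI
  -- the rank over `𝔽_p` is at most `[K : ℚ_p]`
  have hrank : Module.rank (ZMod p) (𝒪[K] ⧸ I) ≤ (Module.finrank ℚ_[p] K : ℕ) := by
    apply rank_le
    intro s hs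
    -- lift the elements of `s` to `O ⊆ K`
    choose x hx using fun m : 𝒪[K] ⧸ I => Ideal.Quotient.mk_surjective m
    have hli : LinearIndependent ℚ_[p] (fun i : s => ((x i : 𝒪[K]) : K)) := by
      rw [Fintype.linearIndependent_iff]
      intro g hg i₁
      by_contra hne
      -- a coefficient of maximal norm
      obtain ⟨i₀, -, hmax⟩ := Finset.exists_max_image Finset.univ (fun i : s => ‖g i‖) ⟨i₁, Finset.mem_univ _⟩
      have hg0 : g i₀ ≠ 0 := fun h => hne (norm_eq_zero.mp (le_antisymm
        (by simpa [h] using hmax i₁ (Finset.mem_univ _)) (norm_nonneg _)))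
      -- normalised coefficients `b i = g i / g i₀ ∈ ℤ_p`, `b i₀ = 1`
      have hb1 : ∀ i, ‖g i / g i₀‖ ≤ 1 := fun i => by
        rw [norm_div]
        exact div_le_one_of_le₀ (hmax i (Finset.mem_univ _)) (norm_nonneg _)
      let b : s → ℤ_[p] := fun i => ⟨g i / g i₀, hb1 i⟩
      have hbi₀ : b i₀ = 1 := Subtype.ext (by simp [b, div_self hg0])
      have hsum : ∑ i, algebraMap ℚ_[p] K (b i : ℚ_[p]) * ((x i : 𝒪[K]) : K) = 0 := by
        have : ∑ i, algebraMap ℚ_[p] K (b i : ℚ_[p]) * ((x i : 𝒪[K]) : K) =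
            algebraMap ℚ_[p] K (g i₀)⁻¹ * ∑ i, g i • ((x i : 𝒪[K]) : K) := by
          rw [Finset.mul_sum]
          refine Finset.sum_congr rfl fun i _ => ?_
          rw [Algebra.smul_def, ← mul_assoc, ← map_mul]
          congr 1
          simp [b, div_eq_inv_mul]
        rw [this, hg, mul_zero]
      -- reduce modulo `p`: the relation `∑ r_i • m_i = 0` in `O / p O` with `r_{i₀} = 1`
      have hred : ∑ i, ((b i).zmodRepr : ZMod p) • (i : 𝒪[K] ⧸ I) = 0 := by
        have h1 : ∀ i, ((b i).zmodRepr : ZMod p) • (i : 𝒪[K] ⧸ I) =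
            Ideal.Quotient.mk I ((b i).zmodRepr • x i) := fun i => by
          rw [Nat.cast_smul_eq_nsmul, map_nsmul, hx]
        simp_rw [h1]
        rw [← map_sum, Ideal.Quotient.eq_zero_iff_mem]
        change _ ∈ Ideal.span {π}
        rw [Ideal.mem_span_singleton]
        -- `∑ r_i x_i = ∑ b_i x_i - ∑ (b_i - r_i) x_i = -p ∑ e_i x_i`
        have hdvd : ∀ i, ∃ z : 𝒪[K], ((b i).zmodRepr • x i : 𝒪[K]) =
            ⟨algebraMap ℚ_[p] K (b i : ℚ_[p]), valuation_algebraMap_padicInt_le_one hc _⟩ * x i - π * z := by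
          intro i
          have h := PadicInt.sub_zmodRepr_mem (b i)
          rw [PadicInt.maximalIdeal_eq_span_p, Ideal.mem_span_singleton] at h
          obtain ⟨e, he⟩ := h
          refine ⟨⟨algebraMap ℚ_[p] K (e : ℚ_[p]), valuation_algebraMap_padicInt_le_one hc _⟩ * x i, ?_⟩
          ext
          have he' : (b i : ℚ_[p]) - ((b i).zmodRepr : ℚ_[p]) = (p : ℚ_[p]) * (e : ℚ_[p]) := by
            have := congrArg (fun z : ℤ_[p] => (z : ℚ_[p])) he
            simpa using this
          have : ((b i).zmodRepr : K) = algebraMap ℚ_[p] K (b i : ℚ_[p]) -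
              ((p : ℕ) : K) * algebraMap ℚ_[p] K (e : ℚ_[p]) := by
            rw [← map_natCast (algebraMap ℚ_[p] K) p, ← map_mul, ← he', map_sub, map_natCast,
              sub_sub_cancel]
          simp [hπ, nsmul_eq_mul, this, sub_mul, mul_assoc]
        choose z hz using hdvd
        refine ⟨-(∑ i, z i), ?_⟩
        rw [Finset.sum_congr rfl fun i _ => hz i, Finset.sum_sub_distrib, ← Finset.mul_sum, mul_neg]
        have h0 : ∑ i, (⟨algebraMap ℚ_[p] K (b i : ℚ_[p]), valuation_algebraMap_padicInt_le_one hc _⟩ : 𝒪[K])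
            * x i = 0 := by
          ext
          simpa using hsum
        rw [h0, zero_sub]
      have := (Fintype.linearIndependent_iff.mp hs) (fun i => ((b i).zmodRepr : ZMod p)) hred i₀
      rw [hbi₀, PadicInt.zmodRepr_unique 1 1 (Fact.out : p.Prime).one_lt (by simp)] at this
      exact one_ne_zero (by exact_mod_cast this)
    have := hli.fintype_card_le_finrank
    simpa using this
  haveI hfin : Module.Finite (ZMod p) (𝒪[K] ⧸ I) :=
    (IsNoetherian.iff_fg (K := ZMod p) (V := 𝒪[K] ⧸ I)).mp
      ((IsNoetherian.iff_rank_lt_aleph0 (K := ZMod p) (V := 𝒪[K] ⧸ I)).mpr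
        (lt_of_le_of_lt hrank (Cardinal.natCast_lt_aleph0)))
  exact (Module.finite_iff_finite (R := ZMod p) (M := 𝒪[K] ⧸ I)).mp hfin

/-! ### An infinitely divisible unit of `O_K` is `1` -/

/-- **Classical input for FrdII Thm. 1.2 (iv)** ("condition (b) `⋂_n (O^×(A))^n = {1}` of [FrdI]
Prop. 1.13 (iii) is always satisfied", FrdII p. 9, via "unit-profinite type"): for `K` a finite
extension of `ℚ_p` (compatible valuative relation), a unit `u` of `O_K` that admits an `n`-th root in `K`
for every `n ≥ 1` equals `1`. Proof: `O_K / p^k O_K` is finite; with `N := #(O_K / p^k O_K)^×` and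
`w^N = u` one gets `u ≡ 1 (mod p^k)` for every `k`, and `⋂_k p^k O_K = 0`.
[cite: MochizukiFrdII2008, Thm 1.2 (iv) p.9] -/
theorem eq_one_of_valuation_eq_one_of_forall_exists_pow_eq
    (hc : ∀ a b : ℚ_[p], algebraMap ℚ_[p] K a ≤ᵥ algebraMap ℚ_[p] K b ↔ a ≤ᵥ b) {u : K}
    (hu : valuation K u = 1) (hdiv : ∀ n : ℕ, 0 < n → ∃ w : K, w ^ n = u) : u = 1 := by
  classical
  have hp1 : valuation K ((p : ℕ) : K) ≤ 1 := by
    rw [← map_natCast (algebraMap ℚ_[p] K), ← PadicInt.coe_natCast]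
    exact valuation_algebraMap_padicInt_le_one hc _
  set π : 𝒪[K] := ⟨((p : ℕ) : K), hp1⟩ with hπ
  set I : Ideal 𝒪[K] := Ideal.span {π} with hI
  haveI hfinI : Finite (𝒪[K] ⧸ I) := finite_integer_quotient_p hc
  have hfg : I.FG := ⟨{π}, by rw [Finset.coe_singleton]⟩
  let u' : 𝒪[K] := ⟨u, le_of_eq hu⟩
  -- `u ≡ 1 mod p^k` for every `k`
  have hcong : ∀ k : ℕ, valuation K (u - 1) ≤ valuation K ((p : ℕ) : K) ^ k := by
    intro k
    haveI : Finite (𝒪[K] ⧸ I ^ k) := Ideal.finite_quotient_pow hfg k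
    set N := Nat.card (𝒪[K] ⧸ I ^ k)ˣ with hN
    have hNpos : 0 < N := Nat.card_pos
    obtain ⟨w, hw⟩ := hdiv N hNpos
    -- `w` is a unit of `O_K`
    have hvw : valuation K w = 1 := by
      have h := congrArg (valuation K) hw
      rw [map_pow, hu] at h
      rcases pow_eq_one_iff.mp h with h' | h'
      · exact h'
      · exact absurd h' hNpos.ne'
    let w' : 𝒪[K] := ⟨w, le_of_eq hvw⟩
    have hw' : w' ^ N = u' := Subtype.ext (by simpa using hw)
    have hwu : IsUnit w' :=
      (Valuation.Integers.isUnit_iff_valuation_eq_one (Valuation.integer.integers (valuation K))).mpr hvw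
    -- in the finite group `(O_K / p^k)^×`, the `N`-th power of the image of `w` is `1`
    have hq : Ideal.Quotient.mk (I ^ k) u' = 1 := by
      obtain ⟨ζ, hζ⟩ := hwu.map (Ideal.Quotient.mk (I ^ k))
      have h1 : ((ζ ^ N : (𝒪[K] ⧸ I ^ k)ˣ) : 𝒪[K] ⧸ I ^ k) = 1 := by
        rw [hN, pow_card_eq_one', Units.val_one]
      rw [Units.val_pow_eq_pow_val, hζ, ← map_pow, hw'] at h1
      exact h1
    rw [← map_one (Ideal.Quotient.mk (I ^ k)), Ideal.Quotient.eq, hI, Ideal.span_singleton_pow,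
      Ideal.mem_span_singleton] at hq
    obtain ⟨z, hz⟩ := hq
    have hz' : u - 1 = ((p : ℕ) : K) ^ k * (z : K) := by
      have := congrArg (fun x : 𝒪[K] => (x : K)) hz
      simpa [hπ] using this
    rw [hz', map_mul, map_pow]
    exact mul_le_of_le_one_right' z.2
  have := eq_zero_of_forall_valuation_le_pow hc hcong
  exact sub_eq_zero.mp this

end PadicFrd

end Literature.AlgebraicGeometry.Frobenioids
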